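import Mathlib.Data.Real.Basic
import Mathlib.Tactic.Linarith
import Mathlib.Tactic.Ring
import HarnessLib
import HarnessLib.Audit
import Summits.CriticalPhenomena.PercolationContinuityZ3.Theorems.PercNearOneGluingNoHeavyLowerTailSahiE3Hit3CoreSteps1
import Summits.CriticalPhenomena.PercolationContinuityZ3.Theorems.PercNearOneGluingNoHeavyLowerTailSahiE3Hit3CoreSteps2
import Summits.CriticalPhenomena.PercolationContinuityZ3.Theorems.PercNearOneGluingNoHeavyLowerTailSahiE3Hit3CoreSteps3
import Summits.CriticalPhenomena.PercolationContinuityZ3.Theorems.PercNearOneGluingNoHeavyLowerTailSahiE3Hit3CoreSteps4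
import Summits.CriticalPhenomena.PercolationContinuityZ3.Theorems.PercNearOneGluingNoHeavyLowerTailSahiE3Hit3CoreSteps5
import Summits.CriticalPhenomena.PercolationContinuityZ3.Theorems.PercNearOneGluingNoHeavyLowerTailSahiE3Hit3CoreSteps6

/-!
# `NoHeavyLowerTail` (crux stmt-CriticalPhenomena-4575), Sahi programme P4 (Holley / monotone coupling):
# the `1+2+3` slot certificate on the pattern `2³` — Fourier–Motzkin replay, stage `r2`

Support file (cell `prim-l12`, seat P4, generation 10; `--supports stmt-CriticalPhenomena-4575`).  No named facts, no sorries;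
standard axioms; def-free; no notation (the slot set is passed as `(M, hM : M = {100, 010, 001, 110, 101, 011, 111})`).

REGIME-FREE EXISTENCE OF THE CERTIFICATE (Fourier–Motzkin).  The canonical 185-item list of `…SahiE3Hit3Pattern` is linear in
the retained masses `r0`, `r1`, `r2`, `r01`, `r02`, `r12`, `rT` with constant coefficients; its right-hand sides are cubic polynomials in the masses.
Eliminating `r01` by the total-mass equation and then `rT`, `r02`, `r12`, `r0`, `r1`, `r2` (Fourier–Motzkin; at every stage the rows implied by the others
are pruned, each pruning certified by an exact redundancy/dominance claim `C·` of `…SahiE3Hit3Alg*`) leaves the final inequalities `F·`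
proved there.  The replay runs backwards: `r2`, `r1`, `r0`, `r12`, `r02`, `rT` are chosen in turn between their bounds (the maximum of the lower bounds);
each compatibility "lower bound ≤ upper bound" is, up to rearrangement, a row of the next stage, possibly weakened by a claim, or a
final inequality — one two-line `linarith` lemma each (`cp_*`; `pt_*` for rows handed down unchanged; `it_*` for the canonical items).
Row numbers refer to HOME prim-l12-p4/code/gen10/x23/plan_hit3.json.
-/

namespace Summit.CriticalPhenomena.PercolationContinuityZ3.Theorems.SahiE3Hit3Cert

/-- Fourier–Motzkin stage `r2`: `r2` can be chosen between its 2 lower and 1 upper bounds (the maximum of the lower bounds),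
every compatibility being a next-stage row, a redundancy claim or a final inequality. [this work] -/
theorem stage_r2 (n02 n12 nT Z nU nD mU2 mU0_1 : ℝ)
    (F39 : -Z * Z * nU + (Z * Z * mU0_1) ≤ 0)
    (F40 : -(Z * (Z + nD) * n02) + -(Z * (Z + nD) * n12) + -(Z * (Z + nD) * nT) - Z * Z * nU + (Z * Z * mU2) + (Z * Z * mU0_1) ≤ 0) :
    ∃ r2 : ℝ,
      0 ≤ r2 ∧
      -(Z * (Z + nD) * n02) - (Z * (Z + nD) * n12) - (Z * (Z + nD) * nT) + (Z * Z * mU2) ≤ r2 ∧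
      r2 ≤ -(-Z * Z * nU + (Z * Z * mU0_1)) := by
  have c_2_28 := cp_2_28 Z nU mU0_1 F39
  have c_266_28 := cp_266_28 n02 n12 nT Z nU nD mU2 mU0_1 F40
  obtain ⟨r2, hr2def⟩ : ∃ r2 : ℝ, max (0) (-(Z * (Z + nD) * n02) - (Z * (Z + nD) * n12) - (Z * (Z + nD) * nT) + (Z * Z * mU2)) = r2 := ⟨_, rfl⟩
  have h2 : 0 ≤ r2 := by rw [← hr2def]; exact le_max_left _ _
  have h266 : -(Z * (Z + nD) * n02) - (Z * (Z + nD) * n12) - (Z * (Z + nD) * nT) + (Z * Z * mU2) ≤ r2 := by rw [← hr2def]; exact le_max_right _ _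
  have h28 : r2 ≤ -(-Z * Z * nU + (Z * Z * mU0_1)) := by rw [← hr2def]; exact max_le c_2_28 (c_266_28)
  exact ⟨r2, h2, h266, h28⟩

end Summit.CriticalPhenomena.PercolationContinuityZ3.Theorems.SahiE3Hit3Cert
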